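import Summits.ValiantsHypothesis.ValiantsHypothesis.Theorems.GrenetZeonDualUnipotentThreeHalvesSlowCoreLedger

/-!
# `GrenetZeon.DualUnipotentThreeHalves` (stmt-ValiantsHypothesis-24318), line `slow_core`, stub (c) `SlowCore.LongMassSlowLawInv`:
# TRANSPOSE SYMMETRY of whole-pencil ledgers and of the (c)-price

The (c)-certificate currency (`SlowCore.Ledger`, `SlowCore.RelCert`) is invariant under TRANSPOSING the pencil: along every line,
`(Nᵀ(x + s v))^p = ((N(x + s v))^p)ᵀ`, so the window degrees of `Nᵀ` are those of `N` with the entry indices swapped.  Hence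
★ `ledger_top_transpose`, ★★ `relCert_transpose` / `relCert_transpose_iff` (same direction space `K`, same order `k`, same price), together with
the bookkeeping `isAffine_transpose`, `transpose_pow_eq_zero` (nilpotency) — so every census ROW of (c) (a priced class of pencils) and every
violator CANDIDATE is closed under `N ↦ Nᵀ` by name (e.g. the lower-hook gauge family and its upper twin), complementing the conjugation transport
✓ `SlowCore.ledger_top_of_conj` and the value-space invariance ✓ `LongMassHomogenise.relCert_iff_of_valueSpace_eq`.

Honest framing.  A symmetry / bookkeeping lemma (`--supports stmt-ValiantsHypothesis-24318`), NOT progress on (c): (c)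
`SlowCore.LongMassSlowLawInv`, S3, the crux 24318, 8062 and `VP ≠ VNP` remain OPEN / NOT proved.  No sorry, no definitions, no named facts.
-/

-- single-conjunct layout: Sub = Summit, duplicated namespace component intended (the name is mandated)
set_option linter.dupNamespace false
set_option autoImplicit false

noncomputable section

namespace Summit.ValiantsHypothesis.ValiantsHypothesis.Theorems.GrenetZeon.LongMassHomogenise

open MvPolynomial Matrix
open scoped BigOperators
open Summit.ValiantsHypothesis.ValiantsHypothesis.Cruxes.TwoDimCoefficients.DimTwoCases (AffMat IsAffine)
open Summit.ValiantsHypothesis.ValiantsHypothesis.Theorems.GrenetZeon.RadicalSplit (lineSubst)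
open Summit.ValiantsHypothesis.ValiantsHypothesis.Theorems.GrenetZeon.SlowCore

variable {n b : ℕ}

/-- The transpose of an affine pencil is affine. -/
theorem isAffine_transpose (N : AffMat n b) (hN : IsAffine N) : IsAffine N.transpose :=
  fun i j => hN j i

/-- The transpose of a nilpotent pencil is nilpotent. -/
theorem transpose_pow_eq_zero (N : AffMat n b) {H : ℕ} (hnil : N ^ H = 0) : N.transpose ^ H = 0 := by
  rw [← Matrix.transpose_pow, hnil, Matrix.transpose_zero]

/-- Along every line, the powers of the transposed pencil are the transposes of the powers. -/
theorem transpose_map_lineSubst_pow (N : AffMat n b) (x v : Fin n × Fin n → ℂ) (p : ℕ) :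
    (N.transpose.map (lineSubst x v)) ^ p = ((N.map (lineSubst x v)) ^ p).transpose := by
  rw [Matrix.transpose_map, Matrix.transpose_pow]

/-- ★ **TRANSPOSE SYMMETRY OF WHOLE-PENCIL LEDGERS**: same direction space, same order. -/
theorem ledger_top_transpose (N : AffMat n b) {K : Submodule ℂ (Fin n × Fin n → ℂ)} {k : ℕ}
    (h : Ledger n b N (fun _ => True) K k) : Ledger n b N.transpose (fun _ => True) K k := by
  intro x v hv p hp i j _ _
  rw [transpose_map_lineSubst_pow, Matrix.transpose_apply]
  exact h x v hv p hp j i trivial trivial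

/-- ★★ **TRANSPOSE SYMMETRY OF THE (c)-PRICE.** -/
theorem relCert_transpose (N : AffMat n b) {P : ℕ} (h : RelCert n b N P) : RelCert n b N.transpose P := by
  obtain ⟨K, k, hK, hprice⟩ := h
  exact ⟨K, k, ledger_top_transpose N hK, hprice⟩

/-- ★★ The (c)-price of `Nᵀ` is the (c)-price of `N`. -/
theorem relCert_transpose_iff (N : AffMat n b) (P : ℕ) : RelCert n b N.transpose P ↔ RelCert n b N P := by
  refine ⟨fun h => ?_, relCert_transpose N⟩
  have := relCert_transpose N.transpose h
  rwa [Matrix.transpose_transpose] at this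

end Summit.ValiantsHypothesis.ValiantsHypothesis.Theorems.GrenetZeon.LongMassHomogenise

end
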